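import Mathlib
import HarnessLib
import Literature.Analysis.FluidPDE.TaoEnstrophyLocalisationProofs
import Summits.NavierStokesRegularity.NavierStokesRegularity.Theorems.PoloidalWindowDoorPoloidalWindowRigidityEnstrophyHotSpot
import Summits.NavierStokesRegularity.NavierStokesRegularity.Theorems.PoloidalWindowDoorPoloidalWindowRigidityStrongMaxPrinciple
import Summits.NavierStokesRegularity.NavierStokesRegularity.Theorems.PoloidalWindowDoorPoloidalWindowRigidityVorticityTranslate

/-!
# Route `PoloidalWindowDoor`, crux `PoloidalWindowRigidity` (K2, stmt-NavierStokesRegularity-19708), residue —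
# M10 AT THE CRITICAL RATE: profiles whose enstrophy production never exceeds the critical rate are trivial

Cell ns-regularity-ideate, seat nsreg-p7 gen 5 (third worker under the K2 lead ns-poloidal-K2-p1; file landed
`--supports stmt-NavierStokesRegularity-19708`).  CENSUS-K2G §16 (mechanism M10, enstrophy Gronwall from `t = −∞`)
settled the SUB-critical stratum: a profile of the route's Type-I class 𝔓(C) with `(−t)⟪ω, Dv ω⟫ ≤ Λ|ω|²`, `Λ < 1`,
is trivial (p473649 `eq_zero_of_subcritical_production`), and located the residue AT the critical rate `Λ = 1`, where
the a-priori bound `(−t)²|ω|² ≤ C₂²` is exactly scale-invariant and the weighted maximum principle gives no decay.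
This file closes the critical case itself:

* `eq_zero_of_critical_production` — **a profile of 𝔓(C) whose enstrophy production satisfies
  `(−t)⟪ω, Dv ω⟫ ≤ |ω|²` EVERYWHERE (the critical rate, non-strict) is identically zero.**
  Proof: `Q = (−t)²|ω|²` is a bounded sub-solution, `∂ₜQ + DQ(v) − ΔQ ≤ −2(−t)²|∇ω|²_F`
  (`…EnstrophyHotSpot.weightedEnstrophy_identity`); if `ω ≢ 0`, the enstrophy hot-spot normal form
  (`exists_enstrophy_hotSpot`, with the limit-closed property «production at most critical») produces `W ∈ 𝔓(C)` whose
  `Q` ATTAINS its supremum `M > 0` at `(−1, 0)`; the parabolic STRONG maximum principle (`…StrongMaxPrinciple`,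
  `dissipation_eq_zero_of_max`) forces `|∇ω_W|²_F ≡ 0` on `(−2, −1) × ℝ³`, so `curl W(−3/2, ·)` is constant, hence
  translation-invariant, and ns-poloidal-K2-p3's stratum (A) (`eq_zero_of_curl_translate_eq_slice`, p451285) gives
  `W ≡ 0` — contradicting `|curl W(−1,0)|² = M > 0`.
* `eq_zero_of_critical_horizontal_strain` — POLOIDAL profiles: if the horizontal strain never exceeds the critical
  rate, `(−t)⟪Dv(t,y) a, a⟫ ≤ ‖a‖²` for all horizontal `a`, the profile is trivial.  So a member of the residue S2′ of
  line `slicesharp-screw` stretches some horizontal direction STRICTLY faster than the critical rate `1/(−t)` at some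
  point — the necessary condition of CENSUS-K2G §16.2 becomes strict — and, in production form, `(−t)⟪ω, Dv ω⟫ > |ω|²`
  somewhere.
* stub currency: `nonflatLiouville_of_critical_production`, `nonflatLiouville_of_critical_horizontal_strain`.

WHAT THIS IS NOT: not a proof of K2 and nothing about Clay (A) — the critical-rate stratum of the residue of crux
`PoloidalWindowRigidity`, settled (bears_on LADDER-NS N0, route PoloidalWindowDoor); establishment in the cell's sense
needs the cross-family referee PASS + independent reproduction.
-/

noncomputable section

-- the summit and its single sub-problem share the name (CONVENTIONS §1), as in every Theorems file
set_option linter.dupNamespace false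

namespace Summit.NavierStokesRegularity.NavierStokesRegularity.Theorems.PoloidalWindowDoorPoloidalWindowRigidityCriticalProduction

open MeasureTheory Set Function Filter Topology TopologicalSpace Metric InnerProductSpace
open scoped RealInnerProductSpace InnerProductSpace Laplacian ContDiff
open Literature.Analysis Literature.Analysis.FluidPDE
open Summit.NavierStokesRegularity.NavierStokesRegularity.Theorems
open Summit.NavierStokesRegularity.NavierStokesRegularity.Theorems.LocalSineTubeDoorProfileAlignedWindowRigidityAncient
open Summit.NavierStokesRegularity.NavierStokesRegularity.Theorems.PoloidalWindowDoorPoloidalWindowRigidityWindow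
open Summit.NavierStokesRegularity.NavierStokesRegularity.Theorems.PoloidalWindowDoorPoloidalWindowRigidityDegenerate
open Summit.NavierStokesRegularity.NavierStokesRegularity.Theorems.PoloidalWindowDoorPoloidalWindowRigidityFlat
open Summit.NavierStokesRegularity.NavierStokesRegularity.Theorems.PoloidalWindowDoorPoloidalWindowRigidityStrainRate
open Summit.NavierStokesRegularity.NavierStokesRegularity.Theorems.PoloidalWindowDoorPoloidalWindowRigidityPoloidalExtremal
open Summit.NavierStokesRegularity.NavierStokesRegularity.Theorems.PoloidalWindowDoorPoloidalWindowRigidityEnstrophyHotSpot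
open Summit.NavierStokesRegularity.NavierStokesRegularity.Theorems.PoloidalWindowDoorPoloidalWindowRigidityStrongMaxPrinciple
open Summit.NavierStokesRegularity.NavierStokesRegularity.Theorems.PoloidalWindowDoorPoloidalWindowRigidityVorticityTranslate

variable {C : ℝ} {v : ℝ → EuclideanSpace ℝ (Fin 3) → EuclideanSpace ℝ (Fin 3)}

/-! ### «Production at most critical» is preserved by the symmetries and the limits of the class -/

/-- Translation invariance of «enstrophy production at most critical». -/
theorem critProd_translate {u : ℝ → EuclideanSpace ℝ (Fin 3) → EuclideanSpace ℝ (Fin 3)} (x₀ : EuclideanSpace ℝ (Fin 3))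
    (h : ∀ s < 0, ∀ y, (-s) * ⟪curl (u s) y, fderiv ℝ (u s) y (curl (u s) y)⟫_ℝ ≤ ⟪curl (u s) y, curl (u s) y⟫_ℝ) :
    ∀ s < 0, ∀ y, (-s) * ⟪curl (fun x => u s (x₀ + x)) y,
        fderiv ℝ (fun x => u s (x₀ + x)) y (curl (fun x => u s (x₀ + x)) y)⟫_ℝ ≤
      ⟪curl (fun x => u s (x₀ + x)) y, curl (fun x => u s (x₀ + x)) y⟫_ℝ := by
  intro s hs y
  rw [curl_translate, fderiv_translate]
  exact h s hs (x₀ + y)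

/-- Scaling invariance of «enstrophy production at most critical» (`nsRescale c`, `c > 0`: both sides pick up `c⁴`
after the substitution `s ↦ c² s`). -/
theorem critProd_nsRescale {u : ℝ → EuclideanSpace ℝ (Fin 3) → EuclideanSpace ℝ (Fin 3)} {c : ℝ} (hc : 0 < c)
    (h : ∀ s < 0, ∀ y, (-s) * ⟪curl (u s) y, fderiv ℝ (u s) y (curl (u s) y)⟫_ℝ ≤ ⟪curl (u s) y, curl (u s) y⟫_ℝ) :
    ∀ s < 0, ∀ y, (-s) * ⟪curl (nsRescale c u s) y,
        fderiv ℝ (nsRescale c u s) y (curl (nsRescale c u s) y)⟫_ℝ ≤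
      ⟪curl (nsRescale c u s) y, curl (nsRescale c u s) y⟫_ℝ := by
  intro s hs y
  have hc2 : 0 < c ^ 2 := pow_pos hc 2
  have key := h (c ^ 2 * s) (mul_neg_of_pos_of_neg hc2 hs) (c • y)
  rw [curl_nsRescale_slice, fderiv_nsRescale_slice]
  simp only [smul_apply, map_smul, real_inner_smul_left, real_inner_smul_right]
  have hc4 : 0 ≤ c ^ 2 * c ^ 2 := by positivity
  nlinarith [mul_le_mul_of_nonneg_left key hc4]

/-- «Enstrophy production at most critical» passes to pointwise limits of gradients. -/
theorem critProd_of_tendsto {w : ℕ → ℝ → EuclideanSpace ℝ (Fin 3) → EuclideanSpace ℝ (Fin 3)}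
    {W : ℝ → EuclideanSpace ℝ (Fin 3) → EuclideanSpace ℝ (Fin 3)}
    (h : ∀ k, ∀ s < 0, ∀ y, (-s) * ⟪curl (w k s) y, fderiv ℝ (w k s) y (curl (w k s) y)⟫_ℝ ≤
      ⟪curl (w k s) y, curl (w k s) y⟫_ℝ)
    (hgrad : ∀ t < 0, ∀ x, Tendsto (fun j => fderiv ℝ (w j t) x) atTop (𝓝 (fderiv ℝ (W t) x))) :
    ∀ s < 0, ∀ y, (-s) * ⟪curl (W s) y, fderiv ℝ (W s) y (curl (W s) y)⟫_ℝ ≤ ⟪curl (W s) y, curl (W s) y⟫_ℝ := by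
  intro s hs y
  have hD := hgrad s hs y
  have hc := tendsto_curl_of_tendsto_fderiv hD
  have happ : Tendsto (fun j => fderiv ℝ (w j s) y (curl (w j s) y)) atTop (𝓝 (fderiv ℝ (W s) y (curl (W s) y))) :=
    ((isBoundedBilinearMap_apply (𝕜 := ℝ) (E := EuclideanSpace ℝ (Fin 3))
      (F := EuclideanSpace ℝ (Fin 3))).continuous.tendsto (fderiv ℝ (W s) y, curl (W s) y)).comp (hD.prodMk_nhds hc)
  have h1 : Tendsto (fun j => (-s) * ⟪curl (w j s) y, fderiv ℝ (w j s) y (curl (w j s) y)⟫_ℝ) atTop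
      (𝓝 ((-s) * ⟪curl (W s) y, fderiv ℝ (W s) y (curl (W s) y)⟫_ℝ)) := (hc.inner happ).const_mul (-s)
  have h2 : Tendsto (fun j => ⟪curl (w j s) y, curl (w j s) y⟫_ℝ) atTop (𝓝 ⟪curl (W s) y, curl (W s) y⟫_ℝ) :=
    hc.inner hc
  exact le_of_tendsto_of_tendsto' h1 h2 fun j => h j s hs y

/-! ### The critical-production stratum is empty -/

/-- **PROFILES WITH AT MOST CRITICAL ENSTROPHY PRODUCTION ARE TRIVIAL** (`Λ = 1`, non-strict; sharpens p473649's
`eq_zero_of_subcritical_production`, `Λ < 1`).  If a profile of the route's Type-I class satisfies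
`(−s)⟪ω, Dv ω⟫(s,y) ≤ |ω(s,y)|²` for all `s < 0`, `y`, then `v ≡ 0`. -/
theorem eq_zero_of_critical_production (hrate : HasTypeITimeDecay C v)
    (hcont : ContinuousOn (uncurry v) (Iio (0 : ℝ) ×ˢ univ))
    (hmild : ∀ s t : ℝ, s < t → t < 0 → ∀ x,
      v t x = UnboundedOperators.heatExtension (v s) (t - s) x - oseenDuhamel 1 s v v t x)
    (hdiv : ∀ t < 0, VectorCalculus.IsDivFree (v t))
    (hprod : ∀ s < 0, ∀ y, (-s) * ⟪curl (v s) y, fderiv ℝ (v s) y (curl (v s) y)⟫_ℝ ≤ ⟪curl (v s) y, curl (v s) y⟫_ℝ) :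
    ∀ t < 0, ∀ x, v t x = 0 := by
  refine eq_zero_of_irrotational hrate hcont hmild hdiv fun s₀ hs₀ y₀ => ?_
  by_contra hne
  have hv : IsTypeIAncientMild C v := isTypeIAncientMild_of_class hrate hcont hmild hdiv
  -- ## the enstrophy hot spot inside the critical-production stratum
  obtain ⟨W, M, hW, hPW, hMpos, hle, hmax⟩ := exists_enstrophy_hotSpot
    (P := fun u => ∀ s < 0, ∀ y, (-s) * ⟪curl (u s) y, fderiv ℝ (u s) y (curl (u s) y)⟫_ℝ ≤
      ⟪curl (u s) y, curl (u s) y⟫_ℝ)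
    (fun u x₀ hu => critProd_translate x₀ hu) (fun u c hc hu => critProd_nsRescale hc hu)
    (fun w W' _ hw _ _ hgrad => critProd_of_tendsto hw hgrad) hv hprod hs₀ hne
  have hWrate : HasTypeITimeDecay C W := hW.hasTypeITimeDecay
  have hWcont : ContinuousOn (uncurry W) (Iio (0 : ℝ) ×ˢ univ) := hW.continuousOn_uncurry
  have hWmild : ∀ s t : ℝ, s < t → t < 0 → ∀ x,
      W t x = UnboundedOperators.heatExtension (W s) (t - s) x - oseenDuhamel 1 s W W t x :=
    fun s t hst ht x => hW.mild_eq_heatExtension hst ht x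
  have hWdiv : ∀ t < 0, VectorCalculus.IsDivFree (W t) := fun t ht => hW.isDivFree ht
  -- ## the critically weighted enstrophy `Q = t² |ω|²` and its dissipation
  set q : ℝ → EuclideanSpace ℝ (Fin 3) → ℝ := fun τ y => ⟪curl (W τ) y, curl (W τ) y⟫_ℝ with hqdef
  set Q : ℝ → EuclideanSpace ℝ (Fin 3) → ℝ := fun τ y => τ ^ 2 * q τ y with hQdef
  set Qt : ℝ → EuclideanSpace ℝ (Fin 3) → ℝ := fun τ y => deriv (fun τ' => Q τ' y) τ with hQtdef
  set D : ℝ → EuclideanSpace ℝ (Fin 3) → ℝ := fun τ y =>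
    2 * τ ^ 2 * frobeniusNormSq (fderiv ℝ (curl (W τ)) y) with hDdef
  have hg : ∀ τ < (0 : ℝ), HasDerivAt (fun τ : ℝ => τ ^ 2) (2 * τ) τ := fun τ _ => by
    simpa using hasDerivAt_pow 2 τ
  have hid := fun τ (hτ : τ < 0) y => weightedEnstrophy_identity hWrate hWcont hWmild hWdiv hg hτ y
  -- ## the slab `[−2, −1/2] × ℝ³`
  have hslab : ∀ t ∈ Icc (-2 : ℝ) (-1 / 2), t < 0 := fun t ht => by linarith [ht.2]
  obtain ⟨B, hB⟩ := bdd_of_hasTypeITimeDecay hWrate (1 / 4) (by norm_num)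
  have hbA : ∀ t ∈ Icc (-2 : ℝ) (-1 / 2), ∀ x, ‖W t x‖ ≤ B := fun t ht x => hB t (by linarith [ht.2]) x
  have hsmω : IsSmoothSpaceTimeOn (Iio 0) (vorticity W) :=
    (show IsSmoothSpaceTimeOn (Iio 0) W from hW.contDiffOn).isSmoothSpaceTimeOn_vorticity isOpen_Iio.uniqueDiffOn
  have hq_c : ContinuousOn (uncurry q) (Icc (-2 : ℝ) (-1 / 2) ×ˢ univ) := by
    have hωc : ContinuousOn (uncurry (vorticity W)) (Icc (-2 : ℝ) (-1 / 2) ×ˢ univ) :=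
      hsmω.continuousOn.mono (prod_mono (fun t ht => hslab t ht) Subset.rfl)
    have h : ContinuousOn (fun z => ⟪uncurry (vorticity W) z, uncurry (vorticity W) z⟫_ℝ)
        (Icc (-2 : ℝ) (-1 / 2) ×ˢ univ) := hωc.inner hωc
    refine h.congr fun z _ => ?_
    simp only [hqdef, uncurry, vorticity_apply]
  have hQ_c : ContinuousOn (uncurry Q) (Icc (-2 : ℝ) (-1 / 2) ×ˢ univ) := by
    have hg1 : ContinuousOn (fun z : ℝ × EuclideanSpace ℝ (Fin 3) => z.1 ^ 2) (Icc (-2 : ℝ) (-1 / 2) ×ˢ univ) :=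
      (continuous_fst.pow 2).continuousOn
    refine (hg1.mul hq_c).congr fun z _ => ?_
    rcases z with ⟨a, b⟩
    rfl
  have hq2 : ∀ t < (0 : ℝ), ContDiff ℝ 2 (q t) := fun t ht => by
    have hΩ : ContDiff ℝ 2 (curl (W t)) :=
      contDiff_curl (n := 2) (analyticOnNhd_slice hWcont (bdd_of_hasTypeITimeDecay hWrate) hWmild ht).contDiff
    exact hΩ.inner ℝ hΩ
  have hQ2 : ∀ t ∈ Icc (-2 : ℝ) (-1 / 2), ContDiff ℝ 2 (Q t) := fun t ht => by
    have h : ContDiff ℝ 2 (fun y => t ^ 2 * q t y) := contDiff_const.mul (hq2 t (hslab t ht))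
    exact h
  have hQt : ∀ x, ∀ t ∈ Icc (-2 : ℝ) (-1 / 2), HasDerivAt (fun τ => Q τ x) (Qt t x) t :=
    fun x t ht => (hid t (hslab t ht) x).1
  have hD0 : ∀ t ∈ Icc (-2 : ℝ) (-1 / 2), ∀ x, 0 ≤ D t x := fun t _ x => by
    simp only [hDdef]
    exact mul_nonneg (by positivity) (frobeniusNormSq_nonneg _)
  have hlawD : ∀ t ∈ Icc (-2 : ℝ) (-1 / 2), ∀ x,
      Qt t x + fderiv ℝ (Q t) x (W t x) - (Δ (Q t)) x ≤ -D t x := by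
    intro t ht x
    have htn : t < 0 := hslab t ht
    have h := (hid t htn x).2
    have hP := hPW t htn x
    have h1 : t ^ 2 * ⟪curl (W t) x, fderiv ℝ (W t) x (curl (W t) x)⟫_ℝ ≤ (-t) * q t x := by
      have h2 := mul_le_mul_of_nonneg_left hP (neg_pos.2 htn).le
      simp only [hqdef]
      nlinarith [h2]
    simp only [hQtdef, hQdef, hDdef, hqdef] at h h1 ⊢
    rw [h]
    nlinarith [h1]
  have hle' : ∀ t ∈ Icc (-2 : ℝ) (-1 / 2), ∀ x, Q t x ≤ M := fun t ht x => by
    have h := hle t (hslab t ht) x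
    rw [neg_sq] at h
    exact h
  have hmaxQ : Q (-1) 0 = M := by
    simp only [hQdef, hqdef, hmax]
    norm_num
  have hts : (-1 : ℝ) ∈ Ioc (-2 : ℝ) (-1 / 2) := by constructor <;> norm_num
  have hdis := dissipation_eq_zero_of_max (t₀ := (-2 : ℝ)) (T := -1 / 2) hbA hQ_c hQ2 hQt hD0 hlawD hle' hts hmaxQ
  -- ## on the slice `s = −3/2` the vorticity gradient vanishes
  have hs₁ : (-3 / 2 : ℝ) ∈ Ioo (-2 : ℝ) (-1) := by constructor <;> norm_num
  have hF : ∀ x, fderiv ℝ (curl (W (-3 / 2))) x = 0 := by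
    intro x
    have h := hdis (-3 / 2) hs₁ x
    have hfrob : frobeniusNormSq (fderiv ℝ (curl (W (-3 / 2))) x) = 0 := by
      have h2 : (2 : ℝ) * (-3 / 2) ^ 2 ≠ 0 := by norm_num
      simp only [hDdef] at h
      exact (mul_eq_zero.1 h).resolve_left h2
    have hn : ‖fderiv ℝ (curl (W (-3 / 2))) x‖ ^ 2 ≤ 0 := by
      have h3 := sq_opNorm_le_frobeniusNormSq (fderiv ℝ (curl (W (-3 / 2))) x)
      rw [hfrob] at h3
      exact h3
    have hn0 : ‖fderiv ℝ (curl (W (-3 / 2))) x‖ = 0 := by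
      nlinarith [norm_nonneg (fderiv ℝ (curl (W (-3 / 2))) x)]
    exact norm_eq_zero.1 hn0
  -- so `curl W(−3/2, ·)` is constant, in particular translation-invariant along `e₀`
  have hΩd : Differentiable ℝ (curl (W (-3 / 2))) :=
    (contDiff_curl (n := 1) (analyticOnNhd_slice hWcont (bdd_of_hasTypeITimeDecay hWrate) hWmild
      (by norm_num)).contDiff).differentiable one_ne_zero
  have hconst : ∀ (y : EuclideanSpace ℝ (Fin 3)) (l : ℝ),
      curl (W (-3 / 2)) (y + l • EuclideanSpace.single 0 (1 : ℝ)) = curl (W (-3 / 2)) y :=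
    fun y l => is_const_of_fderiv_eq_zero hΩd hF _ _
  have he : (EuclideanSpace.single (0 : Fin 3) (1 : ℝ) : EuclideanSpace ℝ (Fin 3)) ≠ 0 := fun h => by
    simpa using congrArg (fun w : EuclideanSpace ℝ (Fin 3) => w 0) h
  have hW0 : ∀ t < 0, ∀ x, W t x = 0 :=
    eq_zero_of_curl_translate_eq_slice hWrate hWcont hWmild hWdiv (by norm_num : (-3 / 2 : ℝ) < 0) he hconst
  -- ## contradiction: `|curl W(−1,0)|² = M > 0`
  have hc0 : curl (W (-1)) 0 = 0 := by
    have hslice : W (-1) = fun _ => 0 := funext fun x => hW0 (-1) (by norm_num) x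
    rw [curl_eq_curlCLM, hslice]
    simp
  rw [hc0, inner_zero_left] at hmax
  exact absurd hmax hMpos.ne

/-- Stub currency: a profile of the class with at most critical enstrophy production is not backward-singular. -/
theorem nonflatLiouville_of_critical_production (hrate : HasTypeITimeDecay C v)
    (hcont : ContinuousOn (uncurry v) (Iio (0 : ℝ) ×ˢ univ))
    (hmild : ∀ s t : ℝ, s < t → t < 0 → ∀ x,
      v t x = UnboundedOperators.heatExtension (v s) (t - s) x - oseenDuhamel 1 s v v t x)
    (hdiv : ∀ t < 0, VectorCalculus.IsDivFree (v t))
    (hprod : ∀ s < 0, ∀ y, (-s) * ⟪curl (v s) y, fderiv ℝ (v s) y (curl (v s) y)⟫_ℝ ≤ ⟪curl (v s) y, curl (v s) y⟫_ℝ) :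
    ¬ IsBackwardSingularPoint v 0 :=
  not_backwardSingular_of_zero (eq_zero_of_critical_production hrate hcont hmild hdiv hprod)

/-! ### Poloidal profiles: the «at most critical horizontal strain» stratum is empty -/

/-- **POLOIDAL PROFILES WHOSE HORIZONTAL STRAIN NEVER EXCEEDS THE CRITICAL RATE ARE TRIVIAL.**  A profile of the class,
poloidal along `e₃` on every slice, with `(−s)⟪Dv(s,y) a, a⟫ ≤ ‖a‖²` for all `s < 0`, `y` and horizontal `a`
(`⟪a, e₃⟫ = 0`), is identically zero.  Equivalently: a member of the residue S2′ stretches some horizontal direction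
STRICTLY above the critical rate, `(−s)⟪Dv(s,y)a, a⟫ > ‖a‖²`, at some point (CENSUS-K2G §16.2 made strict). -/
theorem eq_zero_of_critical_horizontal_strain (hrate : HasTypeITimeDecay C v)
    (hcont : ContinuousOn (uncurry v) (Iio (0 : ℝ) ×ˢ univ))
    (hmild : ∀ s t : ℝ, s < t → t < 0 → ∀ x,
      v t x = UnboundedOperators.heatExtension (v s) (t - s) x - oseenDuhamel 1 s v v t x)
    (hdiv : ∀ t < 0, VectorCalculus.IsDivFree (v t))
    (hpol : ∀ s < 0, ∀ y, ⟪curl (v s) y, EuclideanSpace.single 2 (1 : ℝ)⟫_ℝ = 0)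
    (hstrain : ∀ s < 0, ∀ (y a : EuclideanSpace ℝ (Fin 3)), ⟪a, EuclideanSpace.single 2 (1 : ℝ)⟫_ℝ = 0 →
      (-s) * ⟪fderiv ℝ (v s) y a, a⟫_ℝ ≤ ‖a‖ ^ 2) :
    ∀ t < 0, ∀ x, v t x = 0 := by
  refine eq_zero_of_critical_production hrate hcont hmild hdiv fun s hs y => ?_
  have h := production_le_of_horizontal_strain (Λ := 1) (hpol s hs y) (fun a ha => by
    rw [one_mul]; exact hstrain s hs y a ha)
  rwa [one_mul] at h

/-- Stub currency: **the «at most critical horizontal strain» stratum of the residue is settled** — such a profile is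
not backward-singular. -/
theorem nonflatLiouville_of_critical_horizontal_strain (hrate : HasTypeITimeDecay C v)
    (hcont : ContinuousOn (uncurry v) (Iio (0 : ℝ) ×ˢ univ))
    (hmild : ∀ s t : ℝ, s < t → t < 0 → ∀ x,
      v t x = UnboundedOperators.heatExtension (v s) (t - s) x - oseenDuhamel 1 s v v t x)
    (hdiv : ∀ t < 0, VectorCalculus.IsDivFree (v t))
    (hpol : ∀ s < 0, ∀ y, ⟪curl (v s) y, EuclideanSpace.single 2 (1 : ℝ)⟫_ℝ = 0)
    (hstrain : ∀ s < 0, ∀ (y a : EuclideanSpace ℝ (Fin 3)), ⟪a, EuclideanSpace.single 2 (1 : ℝ)⟫_ℝ = 0 →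
      (-s) * ⟪fderiv ℝ (v s) y a, a⟫_ℝ ≤ ‖a‖ ^ 2) :
    ¬ IsBackwardSingularPoint v 0 :=
  not_backwardSingular_of_zero (eq_zero_of_critical_horizontal_strain hrate hcont hmild hdiv hpol hstrain)

end Summit.NavierStokesRegularity.NavierStokesRegularity.Theorems.PoloidalWindowDoorPoloidalWindowRigidityCriticalProduction

end
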